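import Mathlib
import Summits.Schanuel.Schanuel.Theses.DiophantineDichotomy
import Summits.Schanuel.Schanuel.Theorems.DiophantineDichotomyKhovanskiiApproxTypeEvDefs
import HarnessLib

/-!
# Sketch (crux-ideate round 2, ideator 4) — crux stmt-Schanuel-14972 `KhovanskiiApproxTypeEv`

Idea card `Ideas/rare-field-species.md`.  Two checkable pieces:

* §1 THE CERTIFICATE GAME (pure real arithmetic, PROVED): the adversary's degree profile
  `f n m = (n+1) m / (n (m+1))` (log-degree, base `d`, of the field generated by any `m` of the `n`
  challenger coordinates) is monotone, subadditive, normalised (`f n n = 1`), and equalises EVERY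
  absolute-currency certificate — singleton floors `f n 1`, and for each `m`-sub-tuple the
  Dirichlet-optimal measure `(1 + 1/m) · f n m − (max absolute height exponent) f n 1` — at the value
  `(n+1)/(2n)`, which is `> 1/(n−1)` for every `n ≥ 3` (`threshold_lt_cap`).  This is the
  method-independent form of the in-tree cap.
* §2 THE NAMED MISSING INPUT (typed, `def … : Prop`, NOT asserted): `ExpNotAbelianLiouville` — `e^α`
  (`α ≠ 0` algebraic) is not `ℚ^{ab}`-Liouville, uniformly in the degree (Schmidt's `𝕂`-Liouville
  notion, Bugeaud 2004 p.151; Roth–LeVeque shape, Bugeaud 2004 Thm 2.5 p.59, for a TRANSCENDENTAL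
  target) — and the bookkeeping lemma `abelianChallengers_repelled` (statement only, `sorry`): under it,
  challengers at a Lindemann–Weierstrass point all of whose `y`-coordinates are abelian algebraic
  numbers are repelled at degree exponent `0`, i.e. the abelian-square species is harmless.
-/

noncomputable section

set_option linter.dupNamespace false

namespace Summit.Schanuel.Schanuel.Cruxes.KhovanskiiApproxTypeEv.IdeateR2K4

open Summit.Schanuel.Schanuel.Theses.DiophantineDichotomy (KhovanskiiApproxTypeEv)
open Summit.Schanuel.Schanuel.Cruxes.KhovanskiiApproxTypeEv.AnchoredReduction (ApproxTypeEvAt)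

/-! ## §1 The certificate game -/

/-- The extremal adversary profile: log_d of the degree of the field generated by `m` of the `n`
coordinates of an entangled challenger (`n, m` real for convenience; used at `1 ≤ m ≤ n`). -/
def gameProfile (n m : ℝ) : ℝ := (n + 1) * m / (n * (m + 1))

/-- Normalisation: all `n` coordinates together generate the whole field (degree `d¹`). -/
theorem gameProfile_self {n : ℝ} (hn : 0 < n) : gameProfile n n = 1 := by
  unfold gameProfile
  have h1 : n * (n + 1) ≠ 0 := by positivity
  rw [div_eq_one_iff_eq h1]
  ring

/-- Each single coordinate has degree `d^{(n+1)/(2n)}`. -/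
theorem gameProfile_one {n : ℝ} (hn : 0 < n) : gameProfile n 1 = (n + 1) / (2 * n) := by
  unfold gameProfile
  have h1 : n ≠ 0 := ne_of_gt hn
  field_simp
  ring

/-- EQUALISATION: the Dirichlet-optimal absolute-currency certificate of every `m`-sub-tuple
(exponent `1 + 1/m` in the sub-field degree, times the absolute height `log H / d^{f n 1}`) has
`d`-exponent exactly `(n+1)/(2n)` — the same as the singleton floor `f n 1`. -/
theorem certificate_value {n m : ℝ} (hn : 0 < n) (hm : 0 < m) :
    (1 + 1 / m) * gameProfile n m - gameProfile n 1 = (n + 1) / (2 * n) := by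
  unfold gameProfile
  have h1 : n ≠ 0 := ne_of_gt hn
  have h2 : m ≠ 0 := ne_of_gt hm
  have h3 : m + 1 ≠ 0 := by positivity
  field_simp
  ring

/-- Monotonicity of the profile in `m` (bigger sub-tuples generate bigger fields). -/
theorem gameProfile_mono {n m₁ m₂ : ℝ} (hn : 0 < n) (hm : 0 < m₁) (h : m₁ ≤ m₂) :
    gameProfile n m₁ ≤ gameProfile n m₂ := by
  unfold gameProfile
  have h2 : 0 < m₂ := lt_of_lt_of_le hm h
  rw [div_le_div_iff₀ (by positivity) (by positivity)]
  have key : (n + 1) * m₂ * (n * (m₁ + 1)) - (n + 1) * m₁ * (n * (m₂ + 1)) =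
      (n + 1) * n * (m₂ - m₁) := by ring
  have hnn : 0 ≤ (n + 1) * n * (m₂ - m₁) :=
    mul_nonneg (mul_nonneg (by linarith) hn.le) (sub_nonneg.mpr h)
  linarith

/-- Subadditivity of the profile (composita: `[K_A K_B : ℚ] ≤ [K_A : ℚ][K_B : ℚ]`), on `m ≥ 1`. -/
theorem gameProfile_subadd {n m₁ m₂ : ℝ} (hn : 0 < n) (h1 : 1 ≤ m₁) (h2 : 1 ≤ m₂) :
    gameProfile n (m₁ + m₂) ≤ gameProfile n m₁ + gameProfile n m₂ := by
  unfold gameProfile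
  rw [div_add_div _ _ (by positivity) (by positivity),
    div_le_div_iff₀ (by positivity) (by positivity)]
  have hm1 : 0 < m₁ := by linarith
  have hm2 : 0 < m₂ := by linarith
  nlinarith [mul_pos hn hm1, mul_pos hn hm2, mul_pos hm1 hm2, mul_pos (mul_pos hn hm1) hm2,
    mul_pos (mul_pos hn hn) (mul_pos hm1 hm2), sq_nonneg (m₁ - m₂), mul_pos hn hn]

/-- THE CAP BEATS THE THRESHOLD at every rank `n ≥ 3`: `1/(n−1) < (n+1)/(2n)`.  (At `n = 2` the
inequality reverses: `3/4 < 1`, which is why the Lindemann–Weierstrass layer closed at rank `2`,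
`EvLWTwo`, p123471, with exactly `a = 3/4`.) -/
theorem threshold_lt_cap {n : ℝ} (hn : 3 ≤ n) : 1 / (n - 1) < (n + 1) / (2 * n) := by
  rw [div_lt_div_iff₀ (by linarith) (by linarith)]
  nlinarith

/-- The abelian-square species (coordinates in `n` distinct degree-`p` subfields of one
`(ℤ/p)²`-extension, `d = p²`) is certified only at `1/2`, and `1/(n−1) ≤ 1/2` for `n ≥ 3`
(equality at `n = 3`: a boundary obstruction there, an interior one for `n ≥ 4`). -/
theorem threshold_le_half {n : ℝ} (hn : 3 ≤ n) : 1 / (n - 1) ≤ (1 : ℝ) / 2 := by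
  rw [div_le_div_iff₀ (by linarith) (by norm_num)]
  linarith

/-! ## §2 The named missing input: `e^α` is not `ℚ^{ab}`-Liouville, uniformly in the degree -/

/-- `γ` is an ABELIAN algebraic number: it lies in some cyclotomic field `ℚ(e^{2πi/m})`
(Kronecker–Weber makes this the same as "`ℚ(γ)/ℚ` is an abelian extension"). -/
def IsAbelianAlgebraic (γ : ℂ) : Prop :=
  ∃ m : ℕ, 0 < m ∧
    γ ∈ IntermediateField.adjoin ℚ ({Complex.exp (2 * Real.pi * Complex.I / (m : ℂ))} : Set ℂ)

/-- **Uniform non-`ℚ^{ab}`-Liouville-ness of `e^α`** (the card's named missing input; Roth–LeVeque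
shape for a transcendental target, cf. Schmidt's `𝕂`-Liouville numbers, Bugeaud 2004 p.151, and
Thm 2.5 p.59): for algebraic `α ≠ 0` there are `κ, C` such that for every degree budget `p`,
beyond a threshold `H₀(p)`, every ABELIAN algebraic `γ` that is a root of a non-zero integer
polynomial of degree `≤ p` and height `≤ H` satisfies `|e^α − γ| ≥ exp(−(κ log H + C p))` —
degree exponent ZERO in front of `log H` (heuristic truth by Borel–Cantelli over the polynomially
many abelian fields per conductor: any `κ > 2`).  OPEN; no method in print proves any exponent
`o(p)` here (the `E`-function / Siegel method and every Liouville endgame give `c·p`). -/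
def ExpNotAbelianLiouville : Prop :=
  ∀ α : ℂ, IsAlgebraic ℚ α → α ≠ 0 → ∃ κ C : ℝ, 0 < κ ∧ ∀ p : ℕ, ∃ H₀ : ℕ, ∀ (H : ℕ) (γ : ℂ),
    H₀ ≤ H → IsAbelianAlgebraic γ →
    (∃ P : Polynomial ℤ, P ≠ 0 ∧ P.natDegree ≤ p ∧ (∀ k, |P.coeff k| ≤ (H : ℤ)) ∧
      Polynomial.aeval γ P = 0) →
    Real.exp (-(κ * Real.log H + C * p)) ≤ ‖Complex.exp α - γ‖

/-- FIRST LEMMA (bookkeeping, statement only): under `ExpNotAbelianLiouville`, at a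
Lindemann–Weierstrass point `s ∈ (ℚ̄∖{0})ⁿ` every challenger whose `y`-coordinates are ALL abelian
algebraic numbers is repelled at degree exponent `0` (so with `a = 0 < 1/(n−1)`): the abelian-square
species of the card — the profile on which every absolute-currency certificate, subfield descent and
discriminant rigidity stop at `a = 1/2` — is harmless.  Proof idea: sup norm `≥` the `y_j`-coordinate
defect for any `j`; apply the hypothesis at `α = s j`; take `κ = max_j κ_j`, `C = max_j C_j`,
`H₀(d) = max_j H₀ⱼ(d)`, and absorb `C d` into the `dᵇ` term (`b = 1`). -/
theorem abelianChallengers_repelled (h : ExpNotAbelianLiouville) :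
    ∀ (n : ℕ) (s : Fin n → ℂ), 1 ≤ n → (∀ i, IsAlgebraic ℚ (s i)) → (∀ i, s i ≠ 0) →
      ∃ κ C : ℝ, 0 < κ ∧ ∀ d : ℕ, ∃ H₀ : ℕ, ∀ (H : ℕ) (γ : Fin n ⊕ Fin n → ℂ), H₀ ≤ H →
        (∀ j, IsAbelianAlgebraic (γ (Sum.inr j))) →
        (∀ i, ∃ P : Polynomial ℤ, P ≠ 0 ∧ P.natDegree ≤ d ∧ (∀ k, |P.coeff k| ≤ (H : ℤ)) ∧
          Polynomial.aeval (γ i) P = 0) →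
        Real.exp (-(κ * ((d : ℝ) ^ (0 : ℝ) * Real.log H) + C * (d : ℝ) ^ (1 : ℝ))) ≤
          ‖γ - Sum.elim s (Complex.exp ∘ s)‖ := by
  sorry

/-- Sanity link to the crux's vocabulary: an eventual type with exponent `a = 0` at a point is in
particular one with any `a < 1/(n−1)` allowed by the crux (`0 < 1/(n−1)` for `n ≥ 2`). -/
theorem zero_lt_threshold {n : ℕ} (hn : 2 ≤ n) : (0 : ℝ) < 1 / ((n : ℝ) - 1) := by
  have : (2 : ℝ) ≤ n := by exact_mod_cast hn
  exact div_pos one_pos (by linarith)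

example : KhovanskiiApproxTypeEv ↔ KhovanskiiApproxTypeEv := Iff.rfl

end Summit.Schanuel.Schanuel.Cruxes.KhovanskiiApproxTypeEv.IdeateR2K4
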